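import Mathlib
import Literature.Computability.AlgebraicComplexity.GroupTheoreticMatMul
import Literature.Barriers.MatrixMultiplication.TricoloredSumFreeBarrier
import Literature.Combinatorics.Additive.Pollard
import Summits.MatrixMultiplication.MatrixMultiplication.Theorems.AbelianSTPPSieveVP

/-!
# Representation bookkeeping (B1)–(B3) for STPP families and rule U11-P (Pollard) in kernel

Support file for the abelian STPP census of cell mm-stpp (rung F-M1; candidate route `AbelianSTPPCensusVP`,
leaf T_E/337, rule set vP = vM + U11-G + U11-P; HOME/mm-stpp-lit/POLLARD-KILLS.md v1.2 §§1–2, REF [52]).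

Setting: `(A i, B i, C i)_{i<N}` an STPP family (tree predicate `IsSTPP`, CKSU 2005 Def. 5.1 in the additive
form of BCCGNSU 2017 §3.1) with all sets non-empty in a finite abelian group `H`, `M = |H|`; shapes
`a_i = |A i|`, `b_i = |B i|`, `c_i = |C i|`.  Difference unions (tree `diffUnion`, file `AbelianSTPPSieveVP`):
`X = ⋃_j (B j − A j)`, `Y = ⋃_k (C k − B k)`, `Z′ = ⋃_i (C i − A i)`.

* (B1) `card_diffUnion_AB/BC/AC`: the three unions are disjoint unions, `|X| = Σ aᵢbᵢ = P_AB`,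
  `|Y| = Σ bᵢcᵢ = P_BC`, `|Z′| = Σ cᵢaᵢ = P_CA` (injectivity lemmas `sub_BA_inj`, `sub_CB_inj`, `sub_CA_inj`).
* (B2) `repCount_eq`: for `a ∈ A i`, `c′ ∈ C i` the representations of `c′ − a` in `X + Y` are exactly
  `(b − a) + (c′ − b)`, `b ∈ B i` — the STPP clause read once — so `r_{X,Y}(c′ − a) = bᵢ`.
* (B3) `Nt_le_ubB`: `N_t(X,Y) = Σ_w min(t, r_{X,Y}(w)) ≤ UB_B(t) = Σ aᵢcᵢ·min(t,bᵢ) + t·(M − P_CA)`.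
* `repBookkeeping`: the three facts packaged VERBATIM as the support item `RepBookkeeping` of the candidate route.
* **Rule U11-P in kernel** (`u11PFormB_of_isSTPP`, `u11P_of_isSTPP`, `u11PSound` = VERBATIM the support item
  `U11PSound`): if `|H| = p` is prime then `H ≃+ ℤ/p` and Pollard's theorem (tree,
  `Literature.Combinatorics.Additive.pollard`, Pollard 1974 = Nathanson GTM 165 Thm 2.4) gives
  `t·min(p, P_AB + P_BC − t) ≤ N_t(X,Y) ≤ UB_B(t)` for `1 ≤ t ≤ min(P_AB, P_BC)`; the letter forms A and C are the
  rule for the rotated families `(C,A,B)`, `(B,C,A)` (`IsSTPP.rotate`).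

WHAT THIS IS NOT: necessary conditions only — no STPP family is constructed and no `ω` statement is made; rule
U11-G (Grynkiewicz) is NOT proved here (it needs [Gry10] Thm 1.1/1.2, a separate item).

## References
* H. Cohn, R. Kleinberg, B. Szegedy, C. Umans, FOCS 2005 (arXiv:math/0511460), Def. 5.1.
* J. M. Pollard, J. London Math. Soc. (2) 8 (1974) 460–462; M. B. Nathanson, GTM 165 (1996), Thm 2.4.
* D. J. Grynkiewicz, Israel J. Math. 177 (2010) 413–439 (arXiv:0803.2601), Thm 1.1/1.2 (context for U11-G).
-/

-- single-conjunct summit: the mandated namespace repeats `MatrixMultiplication`.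
set_option linter.dupNamespace false

namespace Summit.MatrixMultiplication.MatrixMultiplication.Theorems

namespace STPPRepCount

open Finset Literature.Computability.AlgebraicComplexity
open scoped Pointwise

variable {H : Type*} [AddCommGroup H] [DecidableEq H] {N : ℕ} {A B C : Fin N → Finset H}

/-! ### (B1) The three difference unions are disjoint unions -/

omit [DecidableEq H] in
/-- `X`-injectivity: `b − a = b′ − a′` with `a ∈ A j`, `b ∈ B j`, `a′ ∈ A j′`, `b′ ∈ B j′` forces `j = j′`,
`a = a′`, `b = b′` (the STPP clause with `u = u′ ∈ C j`). [original] -/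
theorem sub_BA_inj (h : IsSTPP A B C) {j j' : Fin N} (hC : (C j).Nonempty) {a b a' b' : H}
    (ha : a ∈ A j) (hb : b ∈ B j) (ha' : a' ∈ A j') (hb' : b' ∈ B j') (he : b - a = b' - a') :
    j = j' ∧ a = a' ∧ b = b' := by
  obtain ⟨u, hu⟩ := hC
  have key : (a' - a) + (b - b') + (u - u) = 0 := by
    have : (a' - a) + (b - b') + (u - u) = (b - a) - (b' - a') := by abel
    rw [this, he, sub_self]
  obtain ⟨h1, -, h3, h4, -⟩ := h j' j j a ha a' ha' b' hb' b hb u hu u hu key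
  exact ⟨h1.symm, h3, h4.symm⟩

omit [DecidableEq H] in
/-- `Y`-injectivity: `c − b = c′ − b′` with `b ∈ B k`, `c ∈ C k`, `b′ ∈ B k′`, `c′ ∈ C k′` forces `k = k′`,
`b = b′`, `c = c′` (the STPP clause with `s = s′ ∈ A k`). [original] -/
theorem sub_CB_inj (h : IsSTPP A B C) {k k' : Fin N} (hA : (A k).Nonempty) {b c b' c' : H}
    (hb : b ∈ B k) (hc : c ∈ C k) (hb' : b' ∈ B k') (hc' : c' ∈ C k') (he : c - b = c' - b') :
    k = k' ∧ b = b' ∧ c = c' := by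
  obtain ⟨s, hs⟩ := hA
  have key : (s - s) + (b' - b) + (c - c') = 0 := by
    have : (s - s) + (b' - b) + (c - c') = (c - b) - (c' - b') := by abel
    rw [this, he, sub_self]
  obtain ⟨h1, -, -, h4, h5⟩ := h k k' k s hs s hs b hb b' hb' c' hc' c hc key
  exact ⟨h1, h4, h5.symm⟩

omit [DecidableEq H] in
/-- `Z′`-injectivity: `c − a = c′ − a′` with `a ∈ A i`, `c ∈ C i`, `a′ ∈ A i′`, `c′ ∈ C i′` forces `i = i′`,
`a = a′`, `c = c′` (the STPP clause with `t = t′ ∈ B i′`). [original] -/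
theorem sub_CA_inj (h : IsSTPP A B C) {i i' : Fin N} (hB : (B i').Nonempty) {a c a' c' : H}
    (ha : a ∈ A i) (hc : c ∈ C i) (ha' : a' ∈ A i') (hc' : c' ∈ C i') (he : c - a = c' - a') :
    i = i' ∧ a = a' ∧ c = c' := by
  obtain ⟨t, ht⟩ := hB
  have key : (a' - a) + (t - t) + (c - c') = 0 := by
    have : (a' - a) + (t - t) + (c - c') = (c - a) - (c' - a') := by abel
    rw [this, he, sub_self]
  obtain ⟨-, h2, h3, -, h5⟩ := h i' i' i a ha a' ha' t ht t ht c' hc' c hc key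
  exact ⟨h2.symm, h3, h5.symm⟩

/-- `|B j − A j| = |A j| |B j|` (needs `C j ≠ ∅`). [original] -/
theorem card_sub_BA (h : IsSTPP A B C) (j : Fin N) (hC : (C j).Nonempty) :
    (B j - A j).card = (A j).card * (B j).card := by
  rw [← image_sub_product, mul_comm, ← card_product (B j) (A j)]
  refine card_image_of_injOn ?_
  rintro ⟨b, a⟩ hp ⟨b', a'⟩ hq (he : b - a = b' - a')
  simp only [coe_product, Set.mem_prod, mem_coe] at hp hq
  obtain ⟨-, h2, h3⟩ := sub_BA_inj h hC hp.2 hp.1 hq.2 hq.1 he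
  rw [h2, h3]

/-- `|C k − B k| = |B k| |C k|` (needs `A k ≠ ∅`). [original] -/
theorem card_sub_CB (h : IsSTPP A B C) (k : Fin N) (hA : (A k).Nonempty) :
    (C k - B k).card = (B k).card * (C k).card := by
  rw [← image_sub_product, mul_comm, ← card_product (C k) (B k)]
  refine card_image_of_injOn ?_
  rintro ⟨c, b⟩ hp ⟨c', b'⟩ hq (he : c - b = c' - b')
  simp only [coe_product, Set.mem_prod, mem_coe] at hp hq
  obtain ⟨-, h2, h3⟩ := sub_CB_inj h hA hp.2 hp.1 hq.2 hq.1 he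
  rw [h2, h3]

/-- `|C i − A i| = |C i| |A i|` (needs `B i ≠ ∅`). [original] -/
theorem card_sub_CA (h : IsSTPP A B C) (i : Fin N) (hB : (B i).Nonempty) :
    (C i - A i).card = (C i).card * (A i).card := by
  rw [← image_sub_product, ← card_product (C i) (A i)]
  refine card_image_of_injOn ?_
  rintro ⟨c, a⟩ hp ⟨c', a'⟩ hq (he : c - a = c' - a')
  simp only [coe_product, Set.mem_prod, mem_coe] at hp hq
  obtain ⟨-, h2, h3⟩ := sub_CA_inj h hB hp.2 hp.1 hq.2 hq.1 he
  rw [h2, h3]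

/-- The `B j − A j` are pairwise disjoint (needs all `C j ≠ ∅`). [original] -/
theorem pairwiseDisjoint_sub_BA (h : IsSTPP A B C) (hC : ∀ i, (C i).Nonempty) :
    ((univ : Finset (Fin N)) : Set (Fin N)).PairwiseDisjoint fun j => B j - A j := by
  intro j _ j' _ hne
  rw [Function.onFun, disjoint_left]
  intro x hx hx'
  rw [mem_sub] at hx hx'
  obtain ⟨b, hb, a, ha, rfl⟩ := hx
  obtain ⟨b', hb', a', ha', he⟩ := hx'
  exact hne (sub_BA_inj h (hC j) ha hb ha' hb' he.symm).1

/-- The `C k − B k` are pairwise disjoint (needs all `A k ≠ ∅`). [original] -/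
theorem pairwiseDisjoint_sub_CB (h : IsSTPP A B C) (hA : ∀ i, (A i).Nonempty) :
    ((univ : Finset (Fin N)) : Set (Fin N)).PairwiseDisjoint fun k => C k - B k := by
  intro k _ k' _ hne
  rw [Function.onFun, disjoint_left]
  intro x hx hx'
  rw [mem_sub] at hx hx'
  obtain ⟨c, hc, b, hb, rfl⟩ := hx
  obtain ⟨c', hc', b', hb', he⟩ := hx'
  exact hne (sub_CB_inj h (hA k) hb hc hb' hc' he.symm).1

/-- The `C i − A i` are pairwise disjoint (needs all `B i ≠ ∅`). [original] -/
theorem pairwiseDisjoint_sub_CA (h : IsSTPP A B C) (hB : ∀ i, (B i).Nonempty) :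
    ((univ : Finset (Fin N)) : Set (Fin N)).PairwiseDisjoint fun i => C i - A i := by
  intro i _ i' _ hne
  rw [Function.onFun, disjoint_left]
  intro x hx hx'
  rw [mem_sub] at hx hx'
  obtain ⟨c, hc, a, ha, rfl⟩ := hx
  obtain ⟨c', hc', a', ha', he⟩ := hx'
  exact hne (sub_CA_inj h (hB i') ha hc ha' hc' he.symm).1

/-- **(B1)** `|X| = |⋃ (B j − A j)| = Σ |A j| |B j| = P_AB`. [original] -/
theorem card_diffUnion_AB (h : IsSTPP A B C) (hC : ∀ i, (C i).Nonempty) :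
    (diffUnion A B).card = ∑ i, (A i).card * (B i).card := by
  unfold diffUnion
  rw [card_biUnion (pairwiseDisjoint_sub_BA h hC)]
  exact sum_congr rfl fun j _ => card_sub_BA h j (hC j)

/-- **(B1)** `|Y| = |⋃ (C k − B k)| = Σ |B k| |C k| = P_BC`. [original] -/
theorem card_diffUnion_BC (h : IsSTPP A B C) (hA : ∀ i, (A i).Nonempty) :
    (diffUnion B C).card = ∑ i, (B i).card * (C i).card := by
  unfold diffUnion
  rw [card_biUnion (pairwiseDisjoint_sub_CB h hA)]
  exact sum_congr rfl fun k _ => card_sub_CB h k (hA k)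

/-- **(B1)** `|Z′| = |⋃ (C i − A i)| = Σ |C i| |A i| = P_CA`. [original] -/
theorem card_diffUnion_AC (h : IsSTPP A B C) (hB : ∀ i, (B i).Nonempty) :
    (diffUnion A C).card = ∑ i, (C i).card * (A i).card := by
  unfold diffUnion
  rw [card_biUnion (pairwiseDisjoint_sub_CA h hB)]
  exact sum_congr rfl fun i _ => card_sub_CA h i (hB i)

/-! ### (B2) The STPP clause read once: representations of `c′ − a` -/

/-- **(B2)** For `a ∈ A i`, `c′ ∈ C i`, the representations of `c′ − a` as `x + y`, `x ∈ X = ⋃ (B j − A j)`,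
`y ∈ Y = ⋃ (C k − B k)`, are exactly the pairs `(b − a, c′ − b)`, `b ∈ B i`: if
`(b − a″) + (c − b′) = c′ − a` then the STPP clause `(a″ − a) + (b′ − b) + (c′ − c) = 0` forces `j = k = i`,
`a″ = a`, `b′ = b`, `c = c′`. [original] -/
theorem filter_rep_eq (h : IsSTPP A B C) {i : Fin N} {a c' : H} (ha : a ∈ A i) (hc' : c' ∈ C i) :
    ((diffUnion A B ×ˢ diffUnion B C).filter fun p => p.1 + p.2 = c' - a) =
      (B i).image fun b => (b - a, c' - b) := by
  ext ⟨x, y⟩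
  simp only [mem_filter, mem_product, mem_image, Prod.mk.injEq, diffUnion, mem_biUnion, mem_univ,
    true_and]
  constructor
  · rintro ⟨⟨⟨j, hx⟩, ⟨k, hy⟩⟩, hxy⟩
    rw [mem_sub] at hx hy
    obtain ⟨b, hb, a'', ha'', rfl⟩ := hx
    obtain ⟨c, hc, b', hb', rfl⟩ := hy
    have key : (a'' - a) + (b' - b) + (c' - c) = 0 := by
      have : (a'' - a) + (b' - b) + (c' - c) = (c' - a) - ((b - a'') + (c - b')) := by abel
      rw [this, hxy, sub_self]
    obtain ⟨hjk, hki, haa, hbb, hcc⟩ := h j k i a ha a'' ha'' b hb b' hb' c hc c' hc' key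
    subst hjk; subst hki
    exact ⟨b, hb, by rw [haa], by rw [← hbb, hcc]⟩
  · rintro ⟨b, hb, rfl, rfl⟩
    exact ⟨⟨⟨i, sub_mem_sub hb ha⟩, ⟨i, sub_mem_sub hc' hb⟩⟩, by abel⟩

/-- **(B2)** `r_{X,Y}(c′ − a) = |B i|` for `a ∈ A i`, `c′ ∈ C i`. [original] -/
theorem repCount_eq (h : IsSTPP A B C) {i : Fin N} {a c' : H} (ha : a ∈ A i) (hc' : c' ∈ C i) :
    repCount (diffUnion A B) (diffUnion B C) (c' - a) = (B i).card := by
  unfold repCount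
  rw [filter_rep_eq h ha hc']
  exact card_image_of_injective _ fun b b' hbb => sub_left_inj.mp (Prod.mk.inj hbb).1

/-! ### (B3) The ceiling for `N_t(X, Y)` -/

/-- **(B3)** `N_t(X,Y) = Σ_w min(t, r_{X,Y}(w)) ≤ UB_B(t) = Σ_i aᵢcᵢ·min(t, bᵢ) + t·(M − P_CA)`: the `P_CA`
elements `c′ − a` of `Z′` contribute `min(t, bᵢ)` each by (B2), every other group element at most `t`.
[original] -/
theorem Nt_le_ubB [Fintype H] (h : IsSTPP A B C) (hB : ∀ i, (B i).Nonempty) (t : ℕ) :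
    Nt (diffUnion A B) (diffUnion B C) t ≤
      ubB (Fintype.card H) (fun i => (A i).card) (fun i => (B i).card) (fun i => (C i).card) t := by
  unfold Nt ubB pCA
  set X := diffUnion A B
  set Y := diffUnion B C
  rw [← sum_add_sum_compl (diffUnion A C) fun w => min t (repCount X Y w)]
  have h1 : ∑ w ∈ diffUnion A C, min t (repCount X Y w) =
      ∑ i, (A i).card * (C i).card * min t (B i).card := by
    rw [diffUnion, sum_biUnion (pairwiseDisjoint_sub_CA h hB)]
    refine sum_congr rfl fun i _ => ?_
    have hinj : Set.InjOn (fun x : H × H => x.1 - x.2) ↑(C i ×ˢ A i) := by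
      rintro ⟨c, a⟩ hp ⟨c', a'⟩ hq (he : c - a = c' - a')
      simp only [coe_product, Set.mem_prod, mem_coe] at hp hq
      obtain ⟨-, h2, h3⟩ := sub_CA_inj h (hB i) hp.2 hp.1 hq.2 hq.1 he
      rw [h2, h3]
    rw [← image_sub_product, sum_image hinj]
    rw [sum_congr rfl fun (x : H × H) (hx : x ∈ C i ×ˢ A i) =>
      show min t (repCount X Y (x.1 - x.2)) = min t (B i).card by
        rw [mem_product] at hx; rw [repCount_eq h hx.2 hx.1]]
    rw [sum_const, card_product, smul_eq_mul]
    ring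
  have h2 : ∑ w ∈ (diffUnion A C)ᶜ, min t (repCount X Y w) ≤
      t * (Fintype.card H - ∑ i, (C i).card * (A i).card) := by
    calc ∑ w ∈ (diffUnion A C)ᶜ, min t (repCount X Y w)
        ≤ ∑ w ∈ (diffUnion A C)ᶜ, t := sum_le_sum fun w _ => min_le_left _ _
      _ = t * (Fintype.card H - ∑ i, (C i).card * (A i).card) := by
          rw [sum_const, smul_eq_mul, card_compl, card_diffUnion_AC h hB, mul_comm]
  rw [h1]
  exact Nat.add_le_add_left h2 _

/-- **`RepBookkeeping`** — VERBATIM the support item of the candidate route `AbelianSTPPCensusVP`: for an STPP family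
with non-empty sets in a finite abelian group, `|X| = P_AB`, `|Y| = P_BC` and `N_t(X,Y) ≤ UB_B(t)` for every `t`.
[original] -/
theorem repBookkeeping : ∀ (H : Type) [AddCommGroup H] [Fintype H] [DecidableEq H] (N : ℕ)
    (A B C : Fin N → Finset H), IsSTPP A B C →
    (∀ i, (A i).Nonempty ∧ (B i).Nonempty ∧ (C i).Nonempty) →
      (diffUnion A B).card = pAB (fun i => (A i).card) (fun i => (B i).card) (fun i => (C i).card) ∧
      (diffUnion B C).card = pBC (fun i => (A i).card) (fun i => (B i).card) (fun i => (C i).card) ∧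
      ∀ t : ℕ, Nt (diffUnion A B) (diffUnion B C) t ≤
        ubB (Fintype.card H) (fun i => (A i).card) (fun i => (B i).card) (fun i => (C i).card) t := by
  intro H _ _ _ N A B C h hne
  exact ⟨card_diffUnion_AB h fun i => (hne i).2.2, card_diffUnion_BC h fun i => (hne i).1,
    fun t => Nt_le_ubB h (fun i => (hne i).2.1) t⟩

/-! ### Rule U11-P: Pollard's theorem transported to a group of prime order -/

/-- The representation count is invariant under an additive isomorphism. [folklore] -/
theorem repCount_map {G : Type*} [AddCommGroup G] [DecidableEq G] (e : H ≃+ G) (X Y : Finset H)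
    (w : H) :
    repCount (X.map e.toEquiv.toEmbedding) (Y.map e.toEquiv.toEmbedding) (e w) = repCount X Y w := by
  unfold repCount
  refine (card_bij' (fun p _ => (e.symm p.1, e.symm p.2)) (fun p _ => (e p.1, e p.2)) ?_ ?_ ?_ ?_).symm
    |>.symm
  · rintro ⟨x, y⟩ hp
    simp only [mem_filter, mem_product, mem_map_equiv] at hp ⊢
    refine ⟨⟨by simpa using hp.1.1, by simpa using hp.1.2⟩, ?_⟩
    apply e.injective
    simp [hp.2]
  · rintro ⟨x, y⟩ hp
    simp only [mem_filter, mem_product, mem_map_equiv] at hp ⊢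
    refine ⟨⟨by simpa using hp.1.1, by simpa using hp.1.2⟩, ?_⟩
    rw [← map_add, hp.2]
  · rintro ⟨x, y⟩ _; simp
  · rintro ⟨x, y⟩ _; simp

/-- Pollard's theorem (tree: `Literature.Combinatorics.Additive.pollard`, for `ℤ/p`) in any additive group
isomorphic to `ℤ/p`: `t·min(p, |X| + |Y| − t) ≤ N_t(X,Y)` for `1 ≤ t ≤ min(|X|,|Y|)`.
[cite: Pollard1974, Thm 1] [cite: Nathanson1996, Thm 2.4] -/
theorem pollard_of_addEquiv [Fintype H] {p : ℕ} [Fact p.Prime] (e : H ≃+ ZMod p) (X Y : Finset H)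
    {t : ℕ} (ht1 : 1 ≤ t) (htX : t ≤ X.card) (htY : t ≤ Y.card) :
    t * min p (X.card + Y.card - t) ≤ Nt X Y t := by
  have hP := Literature.Combinatorics.Additive.pollard (X.map e.toEquiv.toEmbedding)
    (Y.map e.toEquiv.toEmbedding) ht1 (by rwa [card_map]) (by rwa [card_map])
  rw [card_map, card_map] at hP
  refine hP.trans (le_of_eq ?_)
  unfold Nt
  refine (Fintype.sum_equiv e.toEquiv _ _ fun w => ?_).symm
  show min t (repCount X Y w) = min t (repCount _ _ (e w))
  rw [repCount_map]

omit [DecidableEq H] in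
/-- A finite additive group of prime order `p = |H|` is isomorphic to `ℤ/p` (cyclic of order `p`). [folklore] -/
theorem nonempty_addEquiv_zmod_of_prime_card [Fintype H] (hp : (Fintype.card H).Prime) :
    Nonempty (H ≃+ ZMod (Fintype.card H)) :=
  haveI : Fact (Fintype.card H).Prime := ⟨hp⟩
  have hN : Nat.card H = Fintype.card H := Nat.card_eq_fintype_card
  ⟨(zmodAddCyclicAddEquiv (isAddCyclic_of_prime_card hN)).symm.trans (ZMod.ringEquivCongr hN).toAddEquiv⟩

/-- **Rule U11-P, form B, in kernel**: for an STPP family with non-empty sets in an abelian group of prime order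
`p`, `t·min(p, P_AB + P_BC − t) ≤ UB_B(t)` for every `1 ≤ t ≤ min(P_AB, P_BC)` (Pollard + (B1) + (B3)). [original] -/
theorem u11PFormB_of_isSTPP [Fintype H] (hp : (Fintype.card H).Prime) (h : IsSTPP A B C)
    (hA : ∀ i, (A i).Nonempty) (hB : ∀ i, (B i).Nonempty) (hC : ∀ i, (C i).Nonempty) :
    U11PFormB (Fintype.card H) (fun i => (A i).card) (fun i => (B i).card) (fun i => (C i).card) := by
  intro t ht1 htX htY
  haveI : Fact (Fintype.card H).Prime := ⟨hp⟩
  have hX : (diffUnion A B).card = pAB (fun i => (A i).card) (fun i => (B i).card) (fun i => (C i).card) :=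
    card_diffUnion_AB h hC
  have hY : (diffUnion B C).card = pBC (fun i => (A i).card) (fun i => (B i).card) (fun i => (C i).card) :=
    card_diffUnion_BC h hA
  rw [← hX] at htX ⊢
  rw [← hY] at htY ⊢
  obtain ⟨e⟩ := nonempty_addEquiv_zmod_of_prime_card hp
  exact (pollard_of_addEquiv e _ _ ht1 htX htY).trans (Nt_le_ubB h hB t)

/-- **Rule U11-P (three letter forms) in kernel**: forms A and C are form B for the rotated families
`(C, A, B)` and `(B, C, A)`, which are STPP with the family (`IsSTPP.rotate`). [original] -/
theorem u11P_of_isSTPP [Fintype H] (hp : (Fintype.card H).Prime) (h : IsSTPP A B C)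
    (hA : ∀ i, (A i).Nonempty) (hB : ∀ i, (B i).Nonempty) (hC : ∀ i, (C i).Nonempty) :
    U11P (Fintype.card H) (fun i => (A i).card) (fun i => (B i).card) (fun i => (C i).card) :=
  ⟨u11PFormB_of_isSTPP hp h hA hB hC, u11PFormB_of_isSTPP hp h.rotate.rotate hC hA hB,
    u11PFormB_of_isSTPP hp h.rotate hB hC hA⟩

/-- **`U11PSound`** — VERBATIM the support item of the candidate route `AbelianSTPPCensusVP`: every STPP family with
non-empty sets in an abelian group of prime order satisfies rule U11-P (three letter forms) at its shape list.
[original] -/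
theorem u11PSound : ∀ (H : Type) [AddCommGroup H] [Fintype H], (Fintype.card H).Prime →
    ∀ (N : ℕ) (A B C : Fin N → Finset H), IsSTPP A B C →
    (∀ i, (A i).Nonempty ∧ (B i).Nonempty ∧ (C i).Nonempty) →
      U11P (Fintype.card H) (fun i => (A i).card) (fun i => (B i).card) (fun i => (C i).card) := by
  intro H _ _ hp N A B C h hne
  classical
  exact u11P_of_isSTPP hp h (fun i => (hne i).1) (fun i => (hne i).2.1) fun i => (hne i).2.2

end STPPRepCount

end Summit.MatrixMultiplication.MatrixMultiplication.Theorems
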